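import Literature.AlgebraicGeometry.HodgeTheory.ComplexTorusIntegralHodgeClassesLefschetzClassesIndexOfDegeneracy
import Literature.Geometry.Kaehler.ComplexTorusWeilHodgeClasses
import HarnessLib

/-!
# The EXPLICIT complex torus of Weil type `X = ℂ⁴/Φ(ℤ⁸)` (Voisin ∕ Zucker) on INTEGRAL Hodge classes: `Hdg¹(X, ℤ) = 0`, `rk Hdg²(X, ℤ) ≥ 2`, NO non-zero
# integral Hodge class of codimension `2` is Lefschetz, `ind(X) = 1`

Layer `Literature/AlgebraicGeometry/HodgeTheory`, namespace `Literature.AlgebraicGeometry.HodgeTheory.ComplexTorusCat`; lane `lit-hodgefound` (Track 2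
foundations library, Layer A1/A4), prover seat `lit-hodgefound-p35` (gen 37, row g37-#24). Sequel, BY NAME and without restating anything, of Layer A
`ComplexTorusWeilHodgeClasses` (the EXPLICIT torus of Weil type `X = ℂ⁴/Φ(ℤ⁸)`, `Φ = Weil.periodEquiv` of `ComplexTorusWeilPeriod`: `Weil.hodgeClasses_one_eq_bot`
(`H²_Hodge(X) = 0`, `NS(X) ⊗ ℚ = 0`), `Weil.divisorClasses_two_eq_bot` (`D²(X) = 0`), `Weil.exists_mem_hodgeClasses_two_ne_zero` ∕ `Weil.hodgeClasses_two_ne_divisorClasses_two`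
(`H⁴_Hodge(X) ≠ 0 = D²(X)`), `Weil.two_le_finrank_hodgeClasses_two` (the Weil–Hodge plane)), of g36-#8 (`exists_coe_not_mem_divisorClasses_iff`), `finrank_integralHodgeClasses_eq`
(`rk_ℤ Hdgᵖ(X, ℤ) = dim_ℚ Bᵖ(X)`) and ✔ g37-#18 (`degeneracyIndex_le_of_coe_not_mem_divisorClasses_pow`, Hazama's index on integral classes). The rational statements of
the Layer A file read on the LATTICE `Hdgᵖ(X, ℤ) = H^{2p}(X, ℤ) ∩ H^{p,p}` (`ComplexTorus.integralHodgeClasses`):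

* **`integralHodgeClasses_weilTorus_one_eq_bot`** (`Hdg¹(X, ℤ) = 0`: `X` carries no non-zero integral Hodge class of codimension one — `NS(X) = 0`, `X` is not algebraic),
  **`finrank_integralHodgeClasses_weilTorus_one`** (`rk = 0`);
* **`two_le_finrank_integralHodgeClasses_weilTorus_two`** (`rk_ℤ Hdg²(X, ℤ) ≥ 2`: the Weil–Hodge plane is spanned by integral classes up to isogeny index),
  **`exists_integralHodgeClasses_weilTorus_two_ne_zero`** (a non-zero INTEGRAL Hodge class of type `(2,2)`);
* **`coe_mem_divisorClasses_weilTorus_two_iff_eq_zero`** (an integral Hodge class of codimension `2` is Lefschetz iff it is `0`), **`exists_coe_not_mem_divisorClasses_weilTorus_two`**;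
* **`degeneracyIndex_weilTorus_eq_one`** (`ind(X) = 1`: the exotic classes live on `X` itself).

Theorems only (kernel path): NO definition, NO named fact, no `sorry` (D-0026, net debt 0).

## The sources, as printed

C. Voisin, *A counterexample to the Hodge conjecture extended to Kähler varieties*, IMRN 2002:20, §3, Prop. 3 ((i) "for a general `X` as above, `NS(X) = 0`"; "`⋀⁴_K Γ_ℚ`
is made of Hodge classes"). S. Zucker, *The Hodge conjecture for cubic fourfolds*, Compositio Math. 34 (1977), Appendix B (complex tori with Hodge classes not
generated by divisors). H. Lange, *Abelian Varieties over the Complex Numbers* (2023), §7.2.2 (p0331: the integral Hodge classes `H^{2p}(X, ℤ) ∩ H^{p,p}`), §7.2.4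
Exercises (9)–(10) (the Weil–Hodge cycles form a `ℚ`-plane complementary to `Dⁿ`), §7.3.1 (p0336 L9–L11: "the Hodge (p,p)-conjecture is true if `Dᵖ = H^{2p}_Hodge(X)`").
B. B. Gordon (1999), §8.8 Definition [B.47] (p0023 L25–L32: the index of degeneracy).

## References
* [Voisin2002KaehlerCounterexample] C. Voisin, A counterexample to the Hodge conjecture extended to Kähler varieties, IMRN 2002 — §3, Prop. 3.
* [Zucker1977] S. Zucker, The Hodge conjecture for cubic fourfolds, Compositio Math. 34 (1977) — Appendix B.
* [Lange2023AbelianVarietiesComplex] H. Lange, Abelian Varieties over the Complex Numbers, Springer 2023 — §7.2.2 (p0331), §7.2.4 Exercises (9)–(10), §7.3.1 (p0336 L9–L11).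
* [Gordon1999HodgeAVSurvey] B. B. Gordon, A survey of the Hodge conjecture for abelian varieties, 1999 — §8.8 Definition [B.47] (p0023 L25–L32).
-/

noncomputable section

open CategoryTheory Function

namespace Literature.AlgebraicGeometry.HodgeTheory

open Literature.AlgebraicGeometry.Motives (HodgeTensorFacts hodgeTensorFacts_holds)
open Literature.Geometry.Kaehler Literature.Geometry.Kaehler.ComplexTorus
open Module

namespace ComplexTorusCat

/-! ## §1 Codimension one: `Hdg¹(X, ℤ) = 0` -/

/-- **`Hdg¹(X, ℤ) = 0` FOR THE EXPLICIT WEIL TORUS `X = ℂ⁴/Φ(ℤ⁸)`: no non-zero integral Hodge class of codimension one** (`NS(X) = 0` — `X` is not algebraic; Layer A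
`Weil.hodgeClasses_one_eq_bot` and `Hdgᵖ(X, ℤ) ⊆ Bᵖ(X)`). [cite: Voisin2002KaehlerCounterexample, §3 Prop. 3 (i)] [cite: Lange2023AbelianVarietiesComplex, §7.2.2 (p0331) and §1.3.1] -/
theorem integralHodgeClasses_weilTorus_one_eq_bot : integralHodgeClasses Weil.periodEquiv 1 = ⊥ := by
  refine eq_bot_iff.2 fun γ hγ ↦ ?_
  have h := integralHodgeClasses_subset_hodgeClasses Weil.periodEquiv 1 hγ
  rw [Weil.hodgeClasses_one_eq_bot, SetLike.mem_coe, Submodule.mem_bot] at h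
  exact (AddSubgroup.mem_bot).2 h

/-- **`rk_ℤ Hdg¹(X, ℤ) = 0`** (Layer A `Weil.hodgeClasses_one_eq_bot` + `rk_ℤ Hdgᵖ = dim_ℚ Bᵖ`). [cite: Voisin2002KaehlerCounterexample, §3 Prop. 3 (i)]
[cite: Lange2023AbelianVarietiesComplex, §7.2.2 (p0331)] -/
theorem finrank_integralHodgeClasses_weilTorus_one : finrank ℤ (integralHodgeClasses Weil.periodEquiv 1) = 0 := by
  rw [finrank_integralHodgeClasses_eq (ComplexTorusCat.of ⟨Fin 8, Fin 4 → ℂ, Weil.periodEquiv⟩) 1]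
  change finrank ℚ (hodgeClasses Weil.periodEquiv 1) = 0
  rw [Weil.hodgeClasses_one_eq_bot]
  exact finrank_bot ℚ _

/-! ## §2 Codimension two: integral Weil–Hodge classes, none of them Lefschetz -/

/-- **`rk_ℤ Hdg²(X, ℤ) ≥ 2`**: the Weil–Hodge plane `W ⊂ H⁴_Hodge(X)` (`dim_ℚ W = 2`) gives integral Hodge classes of type `(2,2)` of rank `≥ 2` (Layer A
`Weil.two_le_finrank_hodgeClasses_two` + `rk_ℤ Hdgᵖ = dim_ℚ Bᵖ`). [cite: Lange2023AbelianVarietiesComplex, §7.2.4 Exercises (9)–(10) and §7.2.2 (p0331)]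
[cite: Voisin2002KaehlerCounterexample, §3 ("`⋀⁴_K Γ_ℚ` is made of Hodge classes")] -/
theorem two_le_finrank_integralHodgeClasses_weilTorus_two : 2 ≤ finrank ℤ (integralHodgeClasses Weil.periodEquiv 2) := by
  rw [finrank_integralHodgeClasses_eq (ComplexTorusCat.of ⟨Fin 8, Fin 4 → ℂ, Weil.periodEquiv⟩) 2]
  exact Weil.two_le_finrank_hodgeClasses_two

/-- **AN INTEGRAL HODGE CLASS OF CODIMENSION `2` ON `X` IS LEFSCHETZ IFF IT IS ZERO** (`D²(X) = 0`; Layer A `Weil.divisorClasses_two_eq_bot`).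
[cite: Voisin2002KaehlerCounterexample, §3 Prop. 3] [cite: Lange2023AbelianVarietiesComplex, §7.3.1 (p0336 L9–L11) and §7.2.4 Exercise (10)] -/
theorem coe_mem_divisorClasses_weilTorus_two_iff_eq_zero (x : integralHodgeClasses Weil.periodEquiv 2) :
    ((x : integralHodgeClasses Weil.periodEquiv 2) : (Fin 4 → ℂ) [⋀^Fin (2 * 2)]→L[ℝ] ℂ) ∈ divisorClasses Weil.periodEquiv 2 ↔ x = 0 := by
  rw [Weil.divisorClasses_two_eq_bot, Submodule.mem_bot, ZeroMemClass.coe_eq_zero]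

/-- **`X` CARRIES AN INTEGRAL HODGE CLASS OF CODIMENSION `2` WHICH IS NOT LEFSCHETZ** (`H⁴_Hodge(X) ≠ D²(X)`; Layer A `Weil.hodgeClasses_two_ne_divisorClasses_two` +
g36-#8). [cite: Voisin2002KaehlerCounterexample, §3 Prop. 3] [cite: Zucker1977, Appendix B] [cite: Lange2023AbelianVarietiesComplex, §7.2.4 Exercises (9)–(10) and §7.3.3 Exercise (9)] -/
theorem exists_coe_not_mem_divisorClasses_weilTorus_two :
    ∃ x : integralHodgeClasses Weil.periodEquiv 2,
      ((x : integralHodgeClasses Weil.periodEquiv 2) : (Fin 4 → ℂ) [⋀^Fin (2 * 2)]→L[ℝ] ℂ) ∉ divisorClasses Weil.periodEquiv 2 :=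
  (exists_coe_not_mem_divisorClasses_iff (ComplexTorusCat.of ⟨Fin 8, Fin 4 → ℂ, Weil.periodEquiv⟩)).2 Weil.hodgeClasses_two_ne_divisorClasses_two.symm

/-- **A NON-ZERO INTEGRAL HODGE CLASS OF TYPE `(2,2)` ON THE NON-ALGEBRAIC TORUS `X`** (from the previous statement and `D²(X) = 0`).
[cite: Voisin2002KaehlerCounterexample, §3 Prop. 3] [cite: Zucker1977, Appendix B] -/
theorem exists_integralHodgeClasses_weilTorus_two_ne_zero : ∃ x : integralHodgeClasses Weil.periodEquiv 2, x ≠ 0 := by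
  obtain ⟨x, hx⟩ := exists_coe_not_mem_divisorClasses_weilTorus_two
  exact ⟨x, fun h ↦ hx ((coe_mem_divisorClasses_weilTorus_two_iff_eq_zero x).2 h)⟩

/-! ## §3 The index of degeneracy -/

/-- **`ind(X) = 1` FOR THE EXPLICIT WEIL TORUS**: the exotic classes live on `X` itself (Layer A `Weil.hodgeClasses_two_ne_divisorClasses_two` transported to `X¹ ≅ X`,
`degeneracyIndex_le_of_ne`, `one_le_degeneracyIndex`). [cite: Gordon1999HodgeAVSurvey, §8.8 Definition [B.47] (p0023 L25–L32)] [cite: Voisin2002KaehlerCounterexample, §3 Prop. 3] -/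
theorem degeneracyIndex_weilTorus_eq_one : degeneracyIndex Weil.periodEquiv = 1 := by
  have h1 : divisorClasses (powPeriod Weil.periodEquiv 1) 2 ≠ hodgeClasses (powPeriod Weil.periodEquiv 1) 2 := fun h ↦
    Weil.hodgeClasses_two_ne_divisorClasses_two
      (((isIsomorphic_powPeriod_one Weil.periodEquiv).isIsogenous.divisorClasses_eq_hodgeClasses_iff _ _ 2).2 h).symm
  exact le_antisymm (by simpa using degeneracyIndex_le_of_ne Weil.periodEquiv h1) (one_le_degeneracyIndex _)

end ComplexTorusCat

end Literature.AlgebraicGeometry.HodgeTheory
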